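import Summits.QuantumFields.YangMills.Theses.SteinGapBootstrap
import Summits.QuantumFields.YangMills.Theorems.SteinGapBootstrapGapGivesClusteringGCSForm
import HarnessLib

/-!
# Route `SteinGapBootstrap`, crux K2 `GapGivesClusteringG` (stmt-QuantumFields-22999) — part 2/2 of line «cs-split» (lead-2 seat
# `ym-line-sgb-p2`): the off-diagonal RP-spectral bound from site-RP AT TIME ZERO by the Cauchy–Schwarz split (factor ONE, every `d`),
# and the crux BY NAME modulo negative-coupling site-RP

HONEST FRAMING. This file serves the RECORD-label rung R2xi-G (`WeakCouplingRates.XiPow`, an UPPER bound on the lattice mass gap);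
the Yang–Mills mass gap is NOT proved by anything here, and no summit statement is touched. The crux restricted to `0 ≤ β` is the
lead-1 theorem `SteinGapBootstrap.gapGivesClusteringG_of_nonneg` (already in the tree); this file does NOT restate it.

WHAT IS PROVED (all `sorry`-free, [folklore] throughout; part 1 = `SteinGapBootstrapGapGivesClusteringGCSForm`).
* §4 THE CORE in every dimension `d` (`abs_cov_le_of_siteRP`, every real `β`): if the time-zero RP form of a torus-limit state `μ` is
  non-negative on positive-time observables (site reflection positivity AT TIME ZERO only) and `HasRPTimeGap μ m`, then positive-time
  `A, B` bounded by `a, b` satisfy `|Cov_μ(A∘θ, B∘α_t)| ≤ e^{-mt} a b` for every `t` — FACTOR ONE (the crux asks for `2`). Proof: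
  `t = ⌊t/2⌋ + ⌈t/2⌉`, shift rule, Cauchy–Schwarz for the positive semidefinite symmetric time-zero form (`rpForm_sq_le`, discriminant),
  and the gap hypothesis at the EVEN times `2⌊t/2⌋`, `2⌈t/2⌉` (`rpCorr_two_mul_eq`, `rpCorr_zero_le_sq`). No link-reflection positivity
  and no sign of `rpCorr μ F t` for `t ≥ 1` is used — the birth skeleton's `stub_rpAllTimes` is needed at `t = 0` only.
* §5 `rpCorr_zero_nonneg_of_mem_limitPoints` (every `d`, `β ≥ 0`, every torus-limit state, odd or even sides): `0 ≤ rpCorr μ F 0` for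
  positive-time `F` — GaugeBoot's `siteRP_zero_of_mem_infiniteVolumeLimitPoints` read in the route's currency on the centred observable
  (lead-1's `SteinGapBootstrap.rpCorr_zero_nonneg_of_mem_limitPoints` is the `d = 4` twin).
* §6 `gapGivesClusteringG_of_negSiteRP`: the crux `GapGivesClusteringG` BY NAME, modulo ONE named residual — site-RP at time zero of the
  torus-limit states at NEGATIVE coupling `β < 0`. Along eventually-odd tori at `β < 0` finite-volume site-RP is false (the reflection
  `x₀ ↦ −x₀` of an odd torus also fixes a link hyperplane whose crossing kernel `exp(β Re tr ρ(gh⁻¹))` is of positive type only for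
  `β ≥ 0`) and nothing in print supplies RP of such limit states; the route's Assembly only ever uses `β ≥ β₀`. CONDITIONAL result —
  NOT a proof of the crux as filed (`∀ β : ℝ`); both lead seats returned verdict «misstated: insert `0 ≤ β →`».

References: K. Osterwalder, E. Seiler, Ann. Phys. 110 (1978) 440, §2; E. Seiler, LNP 159 (1982) Ch. 2; J. Glimm, A. Jaffe,
Quantum Physics (1987) §6.1 (Cauchy–Schwarz / spectral form of exponential clustering from a transfer-matrix gap).
-/

set_option autoImplicit false

noncomputable section

open MeasureTheory Filter Topology
open Literature.MathematicalPhysics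
open Literature.MathematicalPhysics.QuantumFieldTheory hiding ZdEdge Site
open Literature.MathematicalPhysics.QuantumLattice
open Summit.QuantumFields.YangMills.Theorems.WeakCouplingRates
open Summit.QuantumFields.GaugeBoot

namespace Summit.QuantumFields.YangMills.Theorems.SteinGapBootstrapK2CS

section Currency

variable {d N : ℕ} [NeZero d] {G : Type*} [Group G] [TopologicalSpace G] [IsTopologicalGroup G] [CompactSpace G]
  [MeasurableSpace G] [BorelSpace G] [SecondCountableTopology G]

variable (ρ : G →* Matrix (Fin N) (Fin N) ℂ)

/-! ### §4 THE CORE: site-RP at time zero + `HasRPTimeGap` ⇒ off-diagonal clustering with factor one -/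

/-- **Cauchy–Schwarz for the time-zero RP form** on positive-time observables of a torus-limit state whose time-zero RP form is positive
semidefinite there: `B₀(F,H)² ≤ B₀(F,F)·B₀(H,H)`. -/
theorem rpForm_sq_le (hρ : Continuous ρ) {β : ℝ} {μ : Measure (LGConfig d G)}
    (hμ : μ ∈ infiniteVolumeLimitPoints (d := d) ρ β)
    (hRP : ∀ F : LGConfig d G → ℝ, IsPosTimeObs F → 0 ≤ rpCorr μ F 0)
    {F H : LGConfig d G → ℝ} (hF : IsPosTimeObs F) (hH : IsPosTimeObs H) :
    ((∫ U, F (timeReflectLG U) * H U ∂μ) - (∫ U, F (timeReflectLG U) ∂μ) * (∫ U, H U ∂μ)) ^ 2 ≤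
      ((∫ U, F (timeReflectLG U) * F U ∂μ) - (∫ U, F (timeReflectLG U) ∂μ) * (∫ U, F U ∂μ)) *
        ((∫ U, H (timeReflectLG U) * H U ∂μ) - (∫ U, H (timeReflectLG U) ∂μ) * (∫ U, H U ∂μ)) := by
  obtain ⟨L, -, hprob, -⟩ := id hμ
  haveI := hprob
  obtain ⟨⟨S, hFS, -⟩, hFc, CF, hCF⟩ := id hF
  obtain ⟨⟨T, hHT, -⟩, hHc, CH, hCH⟩ := id hH
  set p := (∫ U, F (timeReflectLG U) * F U ∂μ) - (∫ U, F (timeReflectLG U) ∂μ) * (∫ U, F U ∂μ) with hp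
  set q := (∫ U, H (timeReflectLG U) * H U ∂μ) - (∫ U, H (timeReflectLG U) ∂μ) * (∫ U, H U ∂μ) with hq
  set b := (∫ U, F (timeReflectLG U) * H U ∂μ) - (∫ U, F (timeReflectLG U) ∂μ) * (∫ U, H U ∂μ) with hb
  have hsymm : (∫ U, H (timeReflectLG U) * F U ∂μ) - (∫ U, H (timeReflectLG U) ∂μ) * (∫ U, F U ∂μ) = b :=
    (rpForm_symm ρ hρ hμ hFS hHT hFc hHc hCF hCH).symm
  have hquad : ∀ c : ℝ, 0 ≤ q * (c * c) + (2 * b) * c + p := by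
    intro c
    have h0 := hRP _ (isPosTimeObs_add_mul hF hH c)
    simp only [rpCorr, timeShiftLG_zero] at h0
    rw [rpForm_add_mul_expand μ hFc hHc hCF hCH c, hsymm] at h0
    rw [← hp, ← hq, ← hb] at h0
    have e : p + c * (b + b) + c ^ 2 * q = q * (c * c) + (2 * b) * c + p := by ring
    rw [e] at h0
    exact h0
  have hd := discrim_le_zero hquad
  rw [discrim] at hd
  nlinarith [hd]

omit [SecondCountableTopology G] in
/-- **The diagonal at time zero is at most the squared sup**: `rpCorr μ A 0 ≤ a²` for `|A| ≤ a` (θ-invariance: `∫A∘θ = ∫A`). -/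
theorem rpCorr_zero_le_sq (hρ : Continuous ρ) {β : ℝ} {μ : Measure (LGConfig d G)}
    (hμ : μ ∈ infiniteVolumeLimitPoints (d := d) ρ β) {A : LGConfig d G → ℝ} (hA : IsPosTimeObs A) {a : ℝ}
    (ha : ∀ U, |A U| ≤ a) : rpCorr μ A 0 ≤ a ^ 2 := by
  obtain ⟨L, -, hprob, -⟩ := id hμ
  haveI := hprob
  obtain ⟨⟨S, hAS, -⟩, hAc, -, -⟩ := id hA
  have hθ := integral_comp_timeReflectLG_of_mem_limitPoints ρ hρ hμ hAS hAc ⟨a, ha⟩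
  simp only [rpCorr, timeShiftLG_zero]
  rw [hθ]
  have h1 : (∫ U, A (timeReflectLG U) * A U ∂μ) ≤ a ^ 2 := by
    have hb : ∀ᵐ U ∂μ, ‖A (timeReflectLG U) * A U‖ ≤ a ^ 2 := ae_of_all _ fun U => by
      rw [Real.norm_eq_abs, abs_mul, sq]
      exact mul_le_mul (ha _) (ha _) (abs_nonneg _) ((abs_nonneg _).trans (ha U))
    have := norm_integral_le_of_norm_le_const hb
    rw [probReal_univ, mul_one, Real.norm_eq_abs] at this
    exact (le_abs_self _).trans this
  nlinarith [mul_self_nonneg (∫ U, A U ∂μ)]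

omit [SecondCountableTopology G] in
/-- **Even-time diagonal = time-zero diagonal of the shifted observable**: `rpCorr μ A (2s) = rpCorr μ (A∘α_s) 0`. -/
theorem rpCorr_two_mul_eq {β : ℝ} {μ : Measure (LGConfig d G)}
    (hμ : μ ∈ infiniteVolumeLimitPoints (d := d) ρ β) {A : LGConfig d G → ℝ} (hA : IsPosTimeObs A) (s : ℕ) :
    rpCorr μ A (2 * s) = rpCorr μ (fun U => A (timeShiftLG (G := G) s U)) 0 := by
  obtain ⟨⟨S, hAS, -⟩, hAc, CA, hCA⟩ := id hA
  have h := cov_eq_rpForm_shift ρ hμ hAS hAS hAc hAc hCA hCA s s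
  simp only [rpCorr, timeShiftLG_zero]
  rw [two_mul]
  exact h

/-- **THE CORE (every real `β`).** For a torus-limit state `μ` whose time-zero RP form is non-negative on positive-time observables
(site reflection positivity at time zero) and every `m` with `HasRPTimeGap μ m`: positive-time `A, B` bounded by `a, b` have
`|Cov_μ(A∘θ, B∘α_t)| ≤ e^{-mt} a b` for every `t` — factor ONE. Cauchy–Schwarz split `t = ⌊t/2⌋ + ⌈t/2⌉`; the gap hypothesis is used only
at the even times `2⌊t/2⌋, 2⌈t/2⌉`; no positivity of `rpCorr μ F t` for `t ≥ 1` (no link RP) is needed. -/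
theorem abs_cov_le_of_siteRP (hρ : Continuous ρ) {β : ℝ} {μ : Measure (LGConfig d G)}
    (hμ : μ ∈ infiniteVolumeLimitPoints (d := d) ρ β)
    (hRP : ∀ F : LGConfig d G → ℝ, IsPosTimeObs F → 0 ≤ rpCorr μ F 0)
    {m : ℝ} (hm : HasRPTimeGap μ m) {A B : LGConfig d G → ℝ} (hA : IsPosTimeObs A) (hB : IsPosTimeObs B)
    {a b : ℝ} (ha : ∀ U, |A U| ≤ a) (hb : ∀ U, |B U| ≤ b) (t : ℕ) :
    |(∫ U, A (timeReflectLG U) * B (timeShiftLG (G := G) t U) ∂μ) -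
        (∫ U, A (timeReflectLG U) ∂μ) * (∫ U, B (timeShiftLG (G := G) t U) ∂μ)| ≤
      Real.exp (-(m * t)) * a * b := by
  obtain ⟨⟨S, hAS, -⟩, hAc, -, -⟩ := id hA
  obtain ⟨⟨T, hBT, -⟩, hBc, -, -⟩ := id hB
  have ha0 : 0 ≤ a := (abs_nonneg _).trans (ha (fun _ => 1))
  have hb0 : 0 ≤ b := (abs_nonneg _).trans (hb (fun _ => 1))
  -- split `t = s + s'`
  set s : ℕ := t / 2 with hs
  set s' : ℕ := t - t / 2 with hs'
  have hss' : s + s' = t := by omega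
  -- the shifted observables
  have hF := isPosTimeObs_timeShift hA s
  have hH := isPosTimeObs_timeShift hB s'
  have hshift := cov_eq_rpForm_shift ρ hμ hAS hBT hAc hBc ha hb s s'
  rw [hss'] at hshift
  rw [hshift]
  -- Cauchy–Schwarz
  have hCS := rpForm_sq_le ρ hρ hμ hRP hF hH
  -- the two diagonals
  have hP0 : 0 ≤ rpCorr μ (fun U => A (timeShiftLG (G := G) s U)) 0 := hRP _ hF
  have hQ0 : 0 ≤ rpCorr μ (fun U => B (timeShiftLG (G := G) s' U)) 0 := hRP _ hH
  have hP : rpCorr μ (fun U => A (timeShiftLG (G := G) s U)) 0 ≤ Real.exp (-(m * (2 * s : ℕ))) * a ^ 2 := by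
    rw [← rpCorr_two_mul_eq ρ hμ hA s]
    exact (hm.2 A hA (2 * s)).trans
      (mul_le_mul_of_nonneg_left (rpCorr_zero_le_sq ρ hρ hμ hA ha) (Real.exp_pos _).le)
  have hQ : rpCorr μ (fun U => B (timeShiftLG (G := G) s' U)) 0 ≤ Real.exp (-(m * (2 * s' : ℕ))) * b ^ 2 := by
    rw [← rpCorr_two_mul_eq ρ hμ hB s']
    exact (hm.2 B hB (2 * s')).trans
      (mul_le_mul_of_nonneg_left (rpCorr_zero_le_sq ρ hρ hμ hB hb) (Real.exp_pos _).le)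
  simp only [rpCorr, timeShiftLG_zero] at hCS hP0 hQ0 hP hQ
  have hexp : Real.exp (-(m * (2 * s : ℕ))) * Real.exp (-(m * (2 * s' : ℕ))) = Real.exp (-(m * t)) ^ 2 := by
    rw [← Real.exp_add, sq, ← Real.exp_add]
    congr 1
    have : (t : ℝ) = s + s' := by rw [← hss']; push_cast; ring
    rw [this]
    push_cast
    ring
  have hprod : ((∫ U, A (timeShiftLG (G := G) s (timeReflectLG U)) * A (timeShiftLG (G := G) s U) ∂μ) -
        (∫ U, A (timeShiftLG (G := G) s (timeReflectLG U)) ∂μ) * (∫ U, A (timeShiftLG (G := G) s U) ∂μ)) *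
      ((∫ U, B (timeShiftLG (G := G) s' (timeReflectLG U)) * B (timeShiftLG (G := G) s' U) ∂μ) -
        (∫ U, B (timeShiftLG (G := G) s' (timeReflectLG U)) ∂μ) * (∫ U, B (timeShiftLG (G := G) s' U) ∂μ)) ≤
      (Real.exp (-(m * t)) * a * b) ^ 2 := by
    calc _ ≤ (Real.exp (-(m * (2 * s : ℕ))) * a ^ 2) * (Real.exp (-(m * (2 * s' : ℕ))) * b ^ 2) :=
          mul_le_mul hP hQ hQ0 (hP0.trans hP)
      _ = (Real.exp (-(m * t)) * a * b) ^ 2 := by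
          rw [show (Real.exp (-(m * t)) * a * b) ^ 2 = Real.exp (-(m * t)) ^ 2 * a ^ 2 * b ^ 2 by ring, ← hexp]
          ring
  exact abs_le_of_sq_le_sq (hCS.trans hprod) (by positivity)

/-! ### §5 Site reflection positivity at time zero of torus-limit states, `β ≥ 0` (GaugeBoot) -/

/-- **Site-RP at time zero, `β ≥ 0`, every torus-limit state (odd or even sides)**: `0 ≤ rpCorr μ F 0` for positive-time `F` — the
GaugeBoot theorem `siteRP_zero_of_mem_infiniteVolumeLimitPoints` applied to the centred observable `F − ∫F dμ`. -/
theorem rpCorr_zero_nonneg_of_mem_limitPoints [T2Space G] (hρ : Continuous ρ) {β : ℝ} (hβ : 0 ≤ β)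
    {μ : Measure (LGConfig d G)} (hμ : μ ∈ infiniteVolumeLimitPoints (d := d) ρ β)
    {F : LGConfig d G → ℝ} (hF : IsPosTimeObs F) : 0 ≤ rpCorr μ F 0 := by
  obtain ⟨L, -, hprob, -⟩ := id hμ
  haveI := hprob
  obtain ⟨⟨S, hFS, hS0⟩, hFc, CF, hCF⟩ := id hF
  have hRP := siteRP_zero_of_mem_infiniteVolumeLimitPoints ρ hρ hβ hμ
  set c : ℝ := ∫ U, F U ∂μ with hc
  have hθ := integral_comp_timeReflectLG_of_mem_limitPoints ρ hρ hμ hFS hFc ⟨CF, hCF⟩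
  -- the centred observable, complexified
  set Fc : LGConfig d G → ℂ := fun U => ((F U - c : ℝ) : ℂ) with hFcdef
  have hmeas : Measurable Fc := (Complex.continuous_ofReal.comp (hFc.sub continuous_const)).measurable
  have hbdd : ∃ C : ℝ, ∀ U, ‖Fc U‖ ≤ C := ⟨CF + |c|, fun U => by
    simp only [hFcdef, Complex.norm_real, Real.norm_eq_abs]
    calc |F U - c| ≤ |F U| + |c| := abs_sub _ _
      _ ≤ CF + |c| := add_le_add (hCF U) le_rfl⟩
  have hdep : DependsOn Fc (siteHalfEdges (d := d) 0) := by
    have hsub : (↑S : Set (QuantumLattice.ZdEdge d)) ⊆ siteHalfEdges (d := d) 0 := fun e he => hS0 e he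
    have hF' : DependsOn F (siteHalfEdges (d := d) 0) := DependsOn.mono hsub hFS
    intro U V hUV
    simp only [hFcdef, hF' hUV]
  have h := hRP Fc hmeas hbdd hdep
  have hfun : (fun U => (starRingEnd ℂ) (Fc (configSiteReflect 0 U)) * Fc U) =
      fun U => (((F (timeReflectLG U) - c) * (F U - c) : ℝ) : ℂ) := by
    funext U
    simp only [hFcdef, Complex.conj_ofReal, ← Complex.ofReal_mul, timeReflectLG_eq_configSiteReflect]
  rw [hfun, integral_complex_ofReal] at h
  have hreal := Complex.zero_le_real.1 h
  -- identify with `rpCorr μ F 0`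
  have iF := integrable_of_continuous_bdd μ hFc hCF
  have iFθ : Integrable (fun U => F (timeReflectLG U)) μ :=
    integrable_of_continuous_bdd μ (hFc.comp continuous_timeReflectLG) (fun U => hCF _)
  have iFF : Integrable (fun U => F (timeReflectLG U) * F U) μ := by
    refine integrable_of_continuous_bdd μ ((hFc.comp continuous_timeReflectLG).mul hFc) (C := CF * CF) fun U => ?_
    rw [abs_mul]
    exact mul_le_mul (hCF _) (hCF _) (abs_nonneg _) ((abs_nonneg _).trans (hCF U))
  have hexpand : (∫ U, (F (timeReflectLG U) - c) * (F U - c) ∂μ) =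
      (∫ U, F (timeReflectLG U) * F U ∂μ) - c * (∫ U, F (timeReflectLG U) ∂μ) - c * (∫ U, F U ∂μ) + c * c := by
    have hpt : (fun U => (F (timeReflectLG U) - c) * (F U - c)) =
        fun U => F (timeReflectLG U) * F U - c * F (timeReflectLG U) - c * F U + c * c := by
      funext U; ring
    have i2 : Integrable (fun U => F (timeReflectLG U) * F U - c * F (timeReflectLG U)) μ := iFF.sub (iFθ.const_mul c)
    have i3 : Integrable (fun U => F (timeReflectLG U) * F U - c * F (timeReflectLG U) - c * F U) μ :=
      i2.sub (iF.const_mul c)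
    rw [hpt, integral_add i3 (integrable_const _), integral_sub i2 (iF.const_mul c), integral_sub iFF (iFθ.const_mul c),
      integral_const_mul, integral_const_mul, integral_const, probReal_univ, one_smul]
  simp only [rpCorr, timeShiftLG_zero]
  rw [hexpand, hθ, hc] at hreal
  rw [hθ]
  linarith [hreal]

end Currency

/-! ### §6 The crux by name, modulo negative-coupling site-RP -/

/-- **K2 `GapGivesClusteringG` BY NAME, modulo ONE residual input: site reflection positivity AT TIME ZERO of the torus-limit states at
NEGATIVE coupling.** For `β ≥ 0` the input is the tree theorem `siteRP_zero_of_mem_infiniteVolumeLimitPoints` (§5); for `β < 0` along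
eventually-odd tori it is not available (finite-volume site-RP is false there: the reflection `x₀ ↦ −x₀` of an odd torus also fixes a link
hyperplane, whose crossing kernel `exp(β Re tr ρ(gh⁻¹))` is of positive type only for `β ≥ 0`) and is not in print; the route's Assembly
never uses `β < 0`. Conditional result: NOT a proof of the crux as filed (`∀ β : ℝ`). -/
theorem gapGivesClusteringG_of_negSiteRP
    (hneg : ∀ (G : Type) [Group G] [TopologicalSpace G] [IsTopologicalGroup G] [CompactSpace G],
      Literature.MathematicalPhysics.QuantumFieldTheory.IsCompactSimpleLieGroup G →
      letI : MeasurableSpace G := borel G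
      haveI : BorelSpace G := ⟨rfl⟩
      ∀ r : Literature.MathematicalPhysics.QuantumFieldTheory.LatticeRep G, ∀ β : ℝ, β < 0 →
      ∀ μ ∈ Literature.MathematicalPhysics.QuantumLattice.infiniteVolumeLimitPoints (d := 4) r.ρ β,
      ∀ F : Literature.MathematicalPhysics.QuantumLattice.LGConfig 4 G → ℝ,
      Summit.QuantumFields.YangMills.Theorems.WeakCouplingRates.IsPosTimeObs F →
      0 ≤ Summit.QuantumFields.YangMills.Theorems.WeakCouplingRates.rpCorr μ F 0) :
    Summit.QuantumFields.YangMills.Theses.SteinGapBootstrap.GapGivesClusteringG := by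
  intro G _ _ _ _ hG
  letI : MeasurableSpace G := borel G
  haveI : BorelSpace G := ⟨rfl⟩
  intro r β μ hμ m hm A B hA hB a b ha hb t
  haveI : SecondCountableTopology G :=
    (r.continuous.isClosedEmbedding r.injective).isEmbedding.secondCountableTopology
  haveI : T2Space G := (r.continuous.isClosedEmbedding r.injective).isEmbedding.t2Space
  have ha0 : 0 ≤ a := (abs_nonneg _).trans (ha (fun _ => 1))
  have hb0 : 0 ≤ b := (abs_nonneg _).trans (hb (fun _ => 1))
  have hRP : ∀ F : LGConfig 4 G → ℝ, IsPosTimeObs F → 0 ≤ rpCorr μ F 0 := by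
    intro F hF
    rcases le_or_gt 0 β with hβ | hβ
    · exact rpCorr_zero_nonneg_of_mem_limitPoints r.ρ r.continuous hβ hμ hF
    · exact hneg G hG r β hβ μ hμ F hF
  have h1 := abs_cov_le_of_siteRP r.ρ r.continuous hμ hRP hm hA hB ha hb t
  have h2 : Real.exp (-(m * t)) * a * b ≤ 2 * Real.exp (-(m * t)) * a * b := by
    have : 0 ≤ Real.exp (-(m * t)) * a * b := by positivity
    linarith
  exact h1.trans h2

end Summit.QuantumFields.YangMills.Theorems.SteinGapBootstrapK2CS

end
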